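import Literature.Geometry.ComplexHyperbolic.UnitBallHyperboloidChart      -- ★ p842622: the chart `ℂ² → 𝔹²`, `pencil_lift_chart` (brings ★ (A3-a) `UnitBallKCentralOrbitalIntegral`, ★ `UnitBallNegativeLineProjector`)
import Literature.Geometry.ComplexHyperbolic.UnitBallKCentralConeLimit       -- ★ p842647: `vecCons_sqrt_smul`, `vecMulVec_real_smul_star_mul_J` (the blow-up `W = √ε·w`)
import Literature.LinearAlgebra.Matrix.UnitaryBlockPauliFrameCasimir        -- ★ (this seat, (A4-0) part 2): `SU2Block.sum_conj_frame_eq_casimir`, `SU2Block.casimir_rhs_smul`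
import HarnessLib

/-!
# The Casimir tensor of `𝔰𝔲(x^⊥)` in the ball chart: the transversal-Hessian frame sum of `U(2,1)` is a polynomial in the pencil `P(lift(g • x₀))`, and its `ε²`-blow-up is
# polynomial on the hyperboloid sheets (ROAD A (A4-0); Rogawski 1990 §8.4, Goldman §3.1.1)

Topic `Geometry/ComplexHyperbolic`; namespace `Literature.Geometry.ComplexHyperbolic.BallModel`.  THEOREMS ONLY (no `def`, no instance, no notation, no axiom, no named fact,
no `sorry`).  Cell `pub/hodgecm-mathlib`, ENGINE T1 (crux H413 = `stmt-HodgeConjecture-24833`); floor-1½ preparation, count-neutral, under row (S-d) ∕ «SdArch» ED. 3 node N1 =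
the (L_{U(2,1)}) letter ★ `ArchCentralLimitFormulaRankTwo` (`stub_ArchCentralLimitU21`): brick **ROAD A (A4-0) «CASIMIR TENSOR OF `𝔰𝔲(x^⊥)` IN THE CHART»** (F0P3a-p05 (g13)
census 19b229d9 §2; A-p14 (g29) census 8d63e285 «frame-free form»; LEAD F0P3a-plan (g10) T9-14 (4); author A-p14 (g29), 2026-09-01).  Over ★ `UnitaryBlockPauliFrameCasimir`
(the frame-free Casimir identity for any `U(H)`), ★ (A3-a) `UnitBallKCentralOrbitalIntegral`, ★ (A3-b) `UnitBallHyperboloidChart`, ★ `UnitBallKCentralConeLimit`.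

THE MATHEMATICS.  In ★ (A2″) `ArchCompactWallTransversalTrace` the transversal second derivative `N²Φ_Θ` of a `K`-central orbital integral at the compact wall is
`∫_G ( ⅓ Σ_{a=1}^{3} D²Θ(h_g)[ζ•Ad(g)y_a, ζ•Ad(g)y_a] − DΘ(h_g)[ζ•Q_g] ) dν(g)` with the Pauli frame `y₁ = I•(E₀₀ − E₁₁)`, `y₂ = E₀₁ − E₁₀`, `y₃ = I•(E₀₁ + E₁₀)` of the
compact block and `Q_g = Ad(g)(E₀₀ + E₁₁)`.  `D²Θ` is only `ℝ`-bilinear.  An explicit `J`-orthonormal frame of the positive plane `(g e₂)^⊥` along the ball (equivalently along the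
hyperboloid sheets `x(W,ε) = (W, √(ε+|W|²))`) cannot be chosen both √-rational and continuous through `W = 0`, but none is needed:
* §1 `Q_g = mat g (E₀₀ + E₁₁) mat g⁻¹ = 1 − P(lift(g • x₀))` (`P(w) = Q(w)⁻¹ • w w^* J` the pencil of ★ (A3-a)) — **`mat_mul_blockProj_mul_mat_inv`**;
* §2 by ★ `SU2Block.sum_conj_frame_eq_casimir` (with `H = J = diag(1,1,−1)`, `M = mat g`, `M′ = mat g⁻¹ = J (mat g)ᴴ J`) the frame sum of EVERY real bilinear `q` is a degree-two
  polynomial in `Π := 1 − P(lift(g • x₀))`: **`sum_conj_frame_eq_casimir_pencil`**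
  `Σ_a q(mat g·y_a·mat g⁻¹)² = Σ_{k,l} ( re(J_kk J_ll) • [q(E_kl Π, Π E_kl) + q(I•E_kl Π, I•Π E_kl)] − q(E_kl Π, E_lk Π) + q(I•E_kl Π, I•E_lk Π) ) − q(I•Π, I•Π)`,
  homogeneous of degree two (**`casimir_pencil_rhs_smul`**); so the whole (A2″) integrand is `Ψ(P(lift(g • x₀)))` for an explicit `Ψ`, and
* §3 `∫_G Ψ(P(lift(g • x₀))) dμ = ∫_{𝔹²} Ψ(P(lift z)) d(π_*μ)` (`= c•∫ dρ` for Haar `μ` and invariant Radon `ρ ≠ 0`) — ★ (A3-a)'s push-forward for pencil functions;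
* §4 in the chart `Π = 1 − P(lift(chart W)) = 1 + N(x(W,1))` (★ `pencil_lift_chart`) and under the blow-up `W = √ε·w` of ★ `UnitBallKCentralConeLimit`
  `ε • (1 + N(x(w,1))) = ε•1 + N(x(√ε•w, ε)) =: Π̃` — a POLYNOMIAL in `(W, W̄, ρ)` on the sheet `ρ = √(ε+|W|²)` (`ε = ρ² − |W|²`), smooth through the cone — hence
  `ε² • RHS(q, Π) = RHS(q, Π̃)` (**`sq_smul_casimir_pencil_rhs_eq_of_smul_eq`**): the `ε⁴`-normalised transversal term is a sheet integral `∫ Λ(W, √(ε+|W|²)) d⁴W` whose datum is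
  built from `D²Θ(h)[ζ•·, ζ•·]` at `37` products of `Π̃(W,ρ)` with CONSTANT matrix units — the input shape of the ★ (A3-c) ENGINE `UnitBallSheetIntegralDeriv` ∕ `UnitBallSheetFamilyDeriv`.
HONEST LABEL: HC_CM is proved only modulo the printed citations until rung 0 closes; this file is linear algebra + `integral_map` over ★ ball-model files and pays nothing by itself.

## References
* [Rogawski1990] J. D. Rogawski, *Automorphic Representations of Unitary Groups in Three Variables*, Ann. of Math. Stud. 123 (1990), §8.4 pp. 126–127 (the singular orbital integrals at the
  compact wall of `U(2,1)` and the central limit formula).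
* [Goldman1999] W. M. Goldman, *Complex Hyperbolic Geometry* (1999), §3.1.1 (negative lines of `ℂ^{2,1}`, their `J`-orthogonal projectors and positive complements; the hyperboloid model).
* [Helgason2000] S. Helgason, *Groups and Geometric Analysis* (2000), Ch. I §1 No. 2, Thm. 1.9 (`∫_G f = ∫_{G∕K} ∫_K`).
* [Jacobowitz1990] H. Jacobowitz, *An Introduction to CR Structures* (1990), Ch. 2 §1 (the ball model of `SU(2,1)`).
* [Hall2015] B. C. Hall, *Lie Groups, Lie Algebras, and Representations*, 2nd ed., GTM 222 (2015), §3.5 (the adjoint action; `Ad(K)` on `𝔰𝔲(2)`).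
-/

set_option autoImplicit false

noncomputable section

open Matrix Complex ComplexConjugate MeasureTheory Measure

namespace Literature.Geometry.ComplexHyperbolic.BallModel

variable {E : Type*} [AddCommGroup E] [Module ℝ E]

/-! ## §1 The conjugated block projector is `1 − P(lift(g • x₀))` -/

/-- `E₀₀ + E₁₁ = 1 − diag(0,0,1)` in `M₃(ℂ)`. [cite: Goldman1999, §3.1.1] -/
theorem single_zero_zero_add_single_one_one :
    Matrix.single (0 : Fin 3) (0 : Fin 3) (1 : ℂ) + Matrix.single 1 1 1 = 1 - Matrix.diagonal ![(0 : ℂ), 0, 1] := by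
  ext i j
  fin_cases i <;> fin_cases j <;> simp [Matrix.diagonal]

/-- `mat g · mat g⁻¹ = 1` and `mat g⁻¹ · mat g = 1`. [cite: Jacobowitz1990, Ch. 2 §1] -/
theorem mat_mul_mat_inv (g : U21) : mat g * mat g⁻¹ = 1 ∧ mat g⁻¹ * mat g = 1 := by
  constructor
  · rw [← mat_mul, mul_inv_cancel, mat_one]
  · rw [← mat_mul, inv_mul_cancel, mat_one]

/-- **THE CONJUGATED BLOCK PROJECTOR IS THE COMPLEMENT OF THE PENCIL**: `mat g · (E₀₀ + E₁₁) · mat g⁻¹ = 1 − P(lift (g • x₀))`, `P(w) = Q(w)⁻¹ • (w w^* J)` — the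
`J`-orthogonal projector onto the positive plane `(g e₂)^⊥ = g · span(e₀, e₁)` (★ `pencil_lift_x₀`, ★ `mat_mul_pencil_mul_mat_inv`, ★ `lift_act`, ★ `pencil_smul`; this is
★ (A2″) 2a §4's `Q_g = 1 − P_g` in `U21` tokens). [cite: Goldman1999, §3.1.1] [cite: Rogawski1990, §8.4 p. 126] -/
theorem mat_mul_blockProj_mul_mat_inv (g : U21) :
    mat g * (Matrix.single (0 : Fin 3) (0 : Fin 3) (1 : ℂ) + Matrix.single 1 1 1) * mat g⁻¹ =
      1 - (((Q (lift (g • x₀)) : ℝ) : ℂ))⁻¹ • (vecMulVec (lift (g • x₀)) (star (lift (g • x₀))) * J) := by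
  have hlift : lift (g • x₀) = (W3 g x₀ 2)⁻¹ • W3 g x₀ := by rw [smul_def, lift_act]
  have hW3 : W3 g x₀ = mat g *ᵥ lift x₀ := rfl
  rw [single_zero_zero_add_single_one_one, Matrix.mul_sub, Matrix.sub_mul, Matrix.mul_one, (mat_mul_mat_inv g).1, ← pencil_lift_x₀,
    mat_mul_pencil_mul_mat_inv, ← hW3, hlift, pencil_smul _ (inv_ne_zero (W3_2_ne_zero g x₀))]

/-- The `U(2,1)` weights: `e_l ∕ e_k = J_kk · J_ll` for `e = (1,1,−1)` (`= +1` on the diagonal blocks, `−1` on the mixed ones). [cite: Goldman1999, §3.1.1] -/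
theorem vecCons_div_vecCons_eq_J_mul_J (k l : Fin 3) : (![(1 : ℂ), 1, -1] l) / (![(1 : ℂ), 1, -1] k) = J k k * J l l := by
  fin_cases k <;> fin_cases l <;> simp [J, Matrix.diagonal]

/-! ## §2 The head at `U(2,1)`: the Pauli-frame sum is a polynomial in the pencil -/

/-- **THE TRANSVERSAL-HESSIAN FRAME SUM IS A POLYNOMIAL IN THE PENCIL** (ROAD A (A4-0), `U(2,1)` instance of ★ `SU2Block.sum_conj_frame_eq_casimir`): for every `g ∈ U(2,1)`,
every real bilinear `q : M₃(ℂ) × M₃(ℂ) → E` and the complementary projector `Π = 1 − P(lift (g • x₀))` of the pencil,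
`Σ_{a=1}^{3} q(mat g · y_a · mat g⁻¹, mat g · y_a · mat g⁻¹) = Σ_{k,l ∈ Fin 3} ( re(J_kk J_ll) • [q(E_kl Π, Π E_kl) + q(I•E_kl Π, I•Π E_kl)] − q(E_kl Π, E_lk Π) + q(I•E_kl Π, I•E_lk Π) ) − q(I•Π, I•Π)`
for the Pauli frame `y₁ = I•(E₀₀ − E₁₁)`, `y₂ = E₀₁ − E₁₀`, `y₃ = I•(E₀₁ + E₁₀)` of the compact block.  With `q = D²Θ(h_g)[ζ•·, ζ•·]` this is the `⅓Σ_a` of ★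
`iteratedDeriv_two_integral_wallLine_eq_integral_third_trace_sub_gradient` read as a function of the point `g • x₀` of the ball: the whole (A2″) integrand is `Ψ(P(lift(g • x₀)))`.
[cite: Rogawski1990, §8.4 p. 126] [cite: Goldman1999, §3.1.1] [cite: Hall2015, §3.5] -/
theorem sum_conj_frame_eq_casimir_pencil (g : U21) (q : Matrix (Fin 3) (Fin 3) ℂ →ₗ[ℝ] Matrix (Fin 3) (Fin 3) ℂ →ₗ[ℝ] E)
    (Pc : Matrix (Fin 3) (Fin 3) ℂ) (hPc : Pc = 1 - (((Q (lift (g • x₀)) : ℝ) : ℂ))⁻¹ • (vecMulVec (lift (g • x₀)) (star (lift (g • x₀))) * J)) :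
    q (mat g * (I • (Matrix.single 0 0 (1 : ℂ) - Matrix.single 1 1 1)) * mat g⁻¹) (mat g * (I • (Matrix.single 0 0 (1 : ℂ) - Matrix.single 1 1 1)) * mat g⁻¹) +
      q (mat g * (Matrix.single 0 1 (1 : ℂ) - Matrix.single 1 0 1) * mat g⁻¹) (mat g * (Matrix.single 0 1 (1 : ℂ) - Matrix.single 1 0 1) * mat g⁻¹) +
      q (mat g * (I • (Matrix.single 0 1 (1 : ℂ) + Matrix.single 1 0 1)) * mat g⁻¹) (mat g * (I • (Matrix.single 0 1 (1 : ℂ) + Matrix.single 1 0 1)) * mat g⁻¹) =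
    (∑ k, ∑ l, ((J k k * J l l).re • (q (Matrix.single k l (1 : ℂ) * Pc) (Pc * Matrix.single k l (1 : ℂ)) +
          q (I • (Matrix.single k l (1 : ℂ) * Pc)) (I • (Pc * Matrix.single k l (1 : ℂ)))) -
        q (Matrix.single k l (1 : ℂ) * Pc) (Matrix.single l k (1 : ℂ) * Pc) +
        q (I • (Matrix.single k l (1 : ℂ) * Pc)) (I • (Matrix.single l k (1 : ℂ) * Pc)))) -
      q (I • Pc) (I • Pc) := by
  have he : ∀ k : Fin 3, (![(1 : ℂ), 1, -1] k) ≠ 0 := by intro k; fin_cases k <;> simp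
  have hereal : ∀ k : Fin 3, conj (![(1 : ℂ), 1, -1] k) = ![(1 : ℂ), 1, -1] k := by intro k; fin_cases k <;> simp
  have hMH : (mat g)ᴴ * Matrix.diagonal ![(1 : ℂ), 1, -1] * mat g = Matrix.diagonal ![(1 : ℂ), 1, -1] := mat_mem g
  have hPc' : Pc = mat g * (Matrix.single (0 : Fin 3) (0 : Fin 3) (1 : ℂ) + Matrix.single 1 1 1) * mat g⁻¹ := by rw [mat_mul_blockProj_mul_mat_inv, hPc]
  have h := Literature.LinearAlgebra.Matrix.SU2Block.sum_conj_frame_eq_casimir q (i := 0) (j := 1) (by decide) he hereal rfl hMH (mat_mul_mat_inv g).1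
    (mat_mul_mat_inv g).2 Pc hPc'
  simp_rw [vecCons_div_vecCons_eq_J_mul_J] at h
  exact h

/-- **HOMOGENEITY IN THE PENCIL COMPLEMENT** (`U(2,1)` weights): replacing `Π` by `c • Π` (`c` real) multiplies the right-hand side by `c²` (★ `SU2Block.casimir_rhs_smul`).
[cite: Rogawski1990, §8.4 p. 126] [cite: Hall2015, §3.5] -/
theorem casimir_pencil_rhs_smul (q : Matrix (Fin 3) (Fin 3) ℂ →ₗ[ℝ] Matrix (Fin 3) (Fin 3) ℂ →ₗ[ℝ] E) (c : ℝ) (Pc : Matrix (Fin 3) (Fin 3) ℂ) :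
    (∑ k, ∑ l, ((J k k * J l l).re • (q (Matrix.single k l (1 : ℂ) * ((c : ℂ) • Pc)) (((c : ℂ) • Pc) * Matrix.single k l (1 : ℂ)) +
          q (I • (Matrix.single k l (1 : ℂ) * ((c : ℂ) • Pc))) (I • (((c : ℂ) • Pc) * Matrix.single k l (1 : ℂ)))) -
        q (Matrix.single k l (1 : ℂ) * ((c : ℂ) • Pc)) (Matrix.single l k (1 : ℂ) * ((c : ℂ) • Pc)) +
        q (I • (Matrix.single k l (1 : ℂ) * ((c : ℂ) • Pc))) (I • (Matrix.single l k (1 : ℂ) * ((c : ℂ) • Pc))))) -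
      q (I • ((c : ℂ) • Pc)) (I • ((c : ℂ) • Pc)) =
    c ^ 2 • ((∑ k, ∑ l, ((J k k * J l l).re • (q (Matrix.single k l (1 : ℂ) * Pc) (Pc * Matrix.single k l (1 : ℂ)) +
          q (I • (Matrix.single k l (1 : ℂ) * Pc)) (I • (Pc * Matrix.single k l (1 : ℂ)))) -
        q (Matrix.single k l (1 : ℂ) * Pc) (Matrix.single l k (1 : ℂ) * Pc) +
        q (I • (Matrix.single k l (1 : ℂ) * Pc)) (I • (Matrix.single l k (1 : ℂ) * Pc)))) -
      q (I • Pc) (I • Pc)) := by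
  have h := Literature.LinearAlgebra.Matrix.SU2Block.casimir_rhs_smul q ![(1 : ℂ), 1, -1] c Pc
  simp_rw [vecCons_div_vecCons_eq_J_mul_J] at h
  exact h

/-! ## §3 Orbital integrals of functions of the pencil are ball averages -/

/-- **ORBITAL INTEGRALS OF PENCIL FUNCTIONS ARE BALL AVERAGES**: for every measure `μ` on `U(2,1)` and every continuous `Ψ : M₃(ℂ) → G`,
`∫_{U(2,1)} Ψ(P(lift(g • x₀))) dμ(g) = ∫_{𝔹²} Ψ(P(lift z)) d(π_*μ)(z)`, `π(g) = g • x₀` — ★ (A3-a) `integral_comp_conj_kCentral_eq_integral_map_orbit` for an arbitrary function of the pencil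
(by §2 the (A2″) integrand is such a `Ψ`). [cite: Helgason2000, Ch. I §1 No. 2, Thm. 1.9] [cite: Rogawski1990, §8.4 pp. 126–127] -/
theorem integral_comp_pencil_orbit_eq_integral_map {G : Type*} [NormedAddCommGroup G] [NormedSpace ℝ G] (μ : Measure U21) (Ψ : Matrix (Fin 3) (Fin 3) ℂ → G)
    (hΨ : Continuous Ψ) :
    ∫ g, Ψ ((((Q (lift (g • x₀)) : ℝ) : ℂ))⁻¹ • (vecMulVec (lift (g • x₀)) (star (lift (g • x₀))) * J)) ∂μ =
      ∫ z, Ψ ((((Q (lift z) : ℝ) : ℂ))⁻¹ • (vecMulVec (lift z) (star (lift z)) * J)) ∂(μ.map fun g : U21 => g • x₀) := by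
  have hπ : Measurable fun g : U21 => g • x₀ := (continuous_id.smul continuous_const).measurable
  have hF : Continuous fun z : Ball => Ψ ((((Q (lift z) : ℝ) : ℂ))⁻¹ • (vecMulVec (lift z) (star (lift z)) * J)) := hΨ.comp continuous_pencil_lift
  haveI : SecondCountableTopology Ball := inferInstanceAs (SecondCountableTopology {z : Fin 2 → ℂ // nsq z < 1})
  rw [integral_map hπ.aemeasurable hF.aestronglyMeasurable]

/-- … and against any invariant Radon measure `ρ ≠ 0` on the ball: for `μ` Haar there is `0 < c` (★ `exists_map_orbit_eq_smul`) with
`∫_{U(2,1)} Ψ(P(lift(g • x₀))) dμ = c • ∫_{𝔹²} Ψ(P(lift z)) dρ` for every continuous `Ψ`. [cite: Helgason2000, Ch. I §1 No. 2, Thm. 1.9] [cite: Rogawski1990, §8.4 pp. 126–127] -/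
theorem exists_integral_comp_pencil_orbit_eq_smul_integral {G : Type*} [NormedAddCommGroup G] [NormedSpace ℝ G] (μ : Measure U21) [μ.IsHaarMeasure]
    (ρ : Measure Ball) [SMulInvariantMeasure U21 Ball ρ] [IsFiniteMeasureOnCompacts ρ] (hρ : ρ ≠ 0) :
    ∃ c : ℝ, 0 < c ∧ ∀ Ψ : Matrix (Fin 3) (Fin 3) ℂ → G, Continuous Ψ →
      ∫ g, Ψ ((((Q (lift (g • x₀)) : ℝ) : ℂ))⁻¹ • (vecMulVec (lift (g • x₀)) (star (lift (g • x₀))) * J)) ∂μ =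
        c • ∫ z, Ψ ((((Q (lift z) : ℝ) : ℂ))⁻¹ • (vecMulVec (lift z) (star (lift z)) * J)) ∂ρ := by
  obtain ⟨c, hc0, hct, hc⟩ := exists_map_orbit_eq_smul μ ρ hρ
  refine ⟨c.toReal, ENNReal.toReal_pos hc0 hct, fun Ψ hΨ => ?_⟩
  rw [integral_comp_pencil_orbit_eq_integral_map μ Ψ hΨ, hc, integral_smul_measure]

/-! ## §4 In the hyperboloid chart: the complement of the pencil is `1 + N(x(W,1))`, and the `ε²`-scaling lands on a POLYNOMIAL of the sheet `Q = −ε` -/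

/-- **IN THE CHART**: `1 − P(lift(chart W)) = 1 + N(W, √(1+|W|²))`, `N(x) = x x^* J` (★ `pencil_lift_chart`). [cite: Goldman1999, §3.1.1] -/
theorem one_sub_pencil_lift_chart (W : Fin 2 → ℂ) :
    1 - (((Q (lift (proj ![W 0, W 1, (Real.sqrt (1 + nsq W) : ℂ)] (Q_vecCons_sqrt_one_add_nsq_neg W))) : ℝ) : ℂ))⁻¹ •
        (vecMulVec (lift (proj ![W 0, W 1, (Real.sqrt (1 + nsq W) : ℂ)] (Q_vecCons_sqrt_one_add_nsq_neg W)))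
          (star (lift (proj ![W 0, W 1, (Real.sqrt (1 + nsq W) : ℂ)] (Q_vecCons_sqrt_one_add_nsq_neg W)))) * J) =
      1 + vecMulVec ![W 0, W 1, (Real.sqrt (1 + nsq W) : ℂ)] (star ![W 0, W 1, (Real.sqrt (1 + nsq W) : ℂ)]) * J := by
  rw [pencil_lift_chart, sub_neg_eq_add]

/-- **THE BLOW-UP OF THE PROJECTOR IS POLYNOMIAL ON THE SHEETS**: `ε • (1 + N(x(w,1))) = ε•1 + N(x(√ε•w, ε))`, `x(W,ε) = (W, √(ε+|W|²))` (`ε ≥ 0`;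
★ `vecCons_sqrt_smul`, ★ `vecMulVec_real_smul_star_mul_J`) — after `W = √ε·w` the complement of the pencil is `ε⁻¹ • Π̃(W)` with `Π̃(W) = ε•1 + N(W, √(ε+|W|²))`
polynomial in `(W, W̄, ρ)`, smooth through the cone `ε = 0`. [cite: Goldman1999, §3.1.1] [cite: Rogawski1990, §8.4 pp. 126–127] -/
theorem smul_one_add_vecMulVec_eq_sheet (w : Fin 2 → ℂ) {ε : ℝ} (hε : 0 ≤ ε) :
    ((ε : ℝ) : ℂ) • ((1 : Matrix (Fin 3) (Fin 3) ℂ) + vecMulVec ![w 0, w 1, (Real.sqrt (1 + nsq w) : ℂ)] (star ![w 0, w 1, (Real.sqrt (1 + nsq w) : ℂ)]) * J) =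
      ((ε : ℝ) : ℂ) • (1 : Matrix (Fin 3) (Fin 3) ℂ) +
        vecMulVec ![(Real.sqrt ε • w) 0, (Real.sqrt ε • w) 1, (Real.sqrt (ε + nsq (Real.sqrt ε • w)) : ℂ)]
          (star ![(Real.sqrt ε • w) 0, (Real.sqrt ε • w) 1, (Real.sqrt (ε + nsq (Real.sqrt ε • w)) : ℂ)]) * J := by
  rw [vecCons_sqrt_smul w hε, vecMulVec_real_smul_star_mul_J _ hε, smul_add]

/-- On the sheet the blow-up parameter is the polynomial `ρ² − |W|²`: `ε = (√(ε+|W|²))² − |W|²` (`ε + |W|² ≥ 0`), so `Π̃(W) = (ρ² − |W|²)•1 + N(W, ρ)` at `ρ = √(ε+|W|²)` —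
the form in which the (A3-c) ENGINE reads a datum `Λ(W, ρ)`. [cite: Goldman1999, §3.1.1] -/
theorem eq_sq_sqrt_sub_nsq (W : Fin 2 → ℂ) {ε : ℝ} (hε : 0 ≤ ε + nsq W) : ε = Real.sqrt (ε + nsq W) ^ 2 - nsq W := by
  rw [Real.sq_sqrt hε, add_sub_cancel_right]

/-- **`ε²` TIMES THE CASIMIR RIGHT-HAND SIDE IS A SHEET DATUM**: if `ε • Π = Π̃` (`ε` real) then `ε² • RHS(q, Π) = RHS(q, Π̃)` for every real bilinear `q` — with
`Π = 1 + N(x(w,1))` and `Π̃ = ε•1 + N(x(√ε•w, ε))` this is ★ `smul_one_add_vecMulVec_eq_sheet`, the (A4-0) socket for the χ-half of ROAD A: under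
★ `integral_bergmanVolume_eq_chart` and the substitution `W = √ε·w` (Mathlib `Measure.integral_comp_smul`, which absorbs another `ε²` as in ★ `sq_smul_integral_bergmanVolume_pencil_eq_chart`),
`ε⁴ · N²Φ(k_ε)` becomes `∫ Λ(W, √(ε+|W|²)) d⁴W` with `Λ` built from `q = D²Θ(h)[ζ•·, ζ•·]` at the `37` products of `Π̃(W, ρ) = (ρ² − |W|²)•1 + N(W, ρ)` with constant matrix units
(jointly smooth for `Θ ∈ C⁴`). [cite: Rogawski1990, §8.4 pp. 126–127] [cite: Goldman1999, §3.1.1] -/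
theorem sq_smul_casimir_pencil_rhs_eq_of_smul_eq (q : Matrix (Fin 3) (Fin 3) ℂ →ₗ[ℝ] Matrix (Fin 3) (Fin 3) ℂ →ₗ[ℝ] E) {ε : ℝ} {Pc Pt : Matrix (Fin 3) (Fin 3) ℂ}
    (hP : ((ε : ℝ) : ℂ) • Pc = Pt) :
    ε ^ 2 • ((∑ k, ∑ l, ((J k k * J l l).re • (q (Matrix.single k l (1 : ℂ) * Pc) (Pc * Matrix.single k l (1 : ℂ)) +
          q (I • (Matrix.single k l (1 : ℂ) * Pc)) (I • (Pc * Matrix.single k l (1 : ℂ)))) -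
        q (Matrix.single k l (1 : ℂ) * Pc) (Matrix.single l k (1 : ℂ) * Pc) +
        q (I • (Matrix.single k l (1 : ℂ) * Pc)) (I • (Matrix.single l k (1 : ℂ) * Pc)))) -
      q (I • Pc) (I • Pc)) =
    (∑ k, ∑ l, ((J k k * J l l).re • (q (Matrix.single k l (1 : ℂ) * Pt) (Pt * Matrix.single k l (1 : ℂ)) +
          q (I • (Matrix.single k l (1 : ℂ) * Pt)) (I • (Pt * Matrix.single k l (1 : ℂ)))) -
        q (Matrix.single k l (1 : ℂ) * Pt) (Matrix.single l k (1 : ℂ) * Pt) +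
        q (I • (Matrix.single k l (1 : ℂ) * Pt)) (I • (Matrix.single l k (1 : ℂ) * Pt)))) -
      q (I • Pt) (I • Pt) := by
  rw [← hP, casimir_pencil_rhs_smul]

end Literature.Geometry.ComplexHyperbolic.BallModel

end
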